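import Mathlib.Algebra.Polynomial.Coeff
import Mathlib.Algebra.Polynomial.Eval.Coeff
import HarnessLib

/-!
# Descent of polynomials along a `p`-power denominator (`pᵏU ∈ A[X]` and `U ∈ B[X]` ⇒ `U ∈ A[X]`)

Topic `RingTheory/DiscreteValuationRing` (proofs only; no definitions, no named facts). Let
`j : A → B` be a ring map and `p ∈ A` such that divisibility by powers of `p` DESCENDS along `j`
(`j(p)ᵏ·x = j(a)` with `x ∈ B` forces `pᵏ ∣ a` in `A` — e.g. `B = A_(p)` for a prime element `p`
of a domain `A`, the tree's `Literature.RingTheory.DiscreteValuationRing.pow_dvd_of_pow_mul_eq`)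
and `j(p)` is not a zero divisor of `B`. Then a polynomial `U ∈ B[X]` with `j(p)ᵏ·U = j(W)` for
some `W ∈ A[X]` comes from `A[X]`: `U = j(U₁)` with `pᵏU₁ = W`
(`exists_map_eq_of_C_pow_mul_eq`). This is the coefficientwise bookkeeping by which polynomial
identities proved over the discrete valuation ring `R̂_(p)` (Blakestad–Grant 2023, proof of
Prop. 7: `S(x), M(x) ∈ R̂[x]`, `A'_{4,p}, A'_{6,p} ∈ R̂`) are brought back to `R̂` once their
`p`-power denominators are known.

## Sources

* N. Bourbaki, *Commutative Algebra*, VII §1 (divisibility in Krull/valuation rings); the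
  statement itself is elementary. [Bourbaki1989CommAlg] [folklore]

Pure proof file.
-/

noncomputable section

open Polynomial

namespace Literature.RingTheory.DiscreteValuationRing

variable {A B : Type*} [CommRing A] [CommRing B] (j : A →+* B) (p : A)

/-- Powers of a non-zero-divisor are non-zero-divisors. [folklore] -/
theorem eq_zero_of_pow_mul_eq_zero (hreg : ∀ x : B, j p * x = 0 → x = 0) (k : ℕ) (x : B)
    (hx : j p ^ k * x = 0) : x = 0 := by
  induction k generalizing x with
  | zero => simpa using hx
  | succ m ih =>
    apply ih
    apply hreg
    rw [← mul_assoc, ← pow_succ', hx]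

/-- **Coefficientwise `p`-power descent.** If `j(p)ᵏx = j(a)` (`x ∈ B`) always forces `pᵏ ∣ a`
in `A`, and `j(p)` is a non-zero-divisor of `B`, then every `U ∈ B[X]` with `j(p)ᵏ·U = j(W)`,
`W ∈ A[X]`, is `j(U₁)` for a (unique) `U₁ ∈ A[X]` with `pᵏ·U₁ = W`. [folklore] -/
theorem exists_map_eq_of_C_pow_mul_eq
    (hdesc : ∀ (a : A) (k : ℕ) (x : B), j p ^ k * x = j a → p ^ k ∣ a)
    (hreg : ∀ x : B, j p * x = 0 → x = 0) {k : ℕ} {U : B[X]} {W : A[X]}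
    (h : C (j p) ^ k * U = W.map j) :
    ∃ U₁ : A[X], U₁.map j = U ∧ C p ^ k * U₁ = W := by
  classical
  -- coefficientwise: `j(p)ᵏ·Uᵢ = j(Wᵢ)`, so `Wᵢ = pᵏcᵢ`
  have hcoeff : ∀ i, j p ^ k * U.coeff i = j (W.coeff i) := by
    intro i
    have := congrArg (Polynomial.coeff · i) h
    simpa only [← C_pow, coeff_C_mul, coeff_map] using this
  have hdvd : ∀ i, p ^ k ∣ W.coeff i := fun i => hdesc _ k _ (hcoeff i)
  choose c hc using hdvd
  -- cancel `j(p)ᵏ`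
  have hcU : ∀ i, j (c i) = U.coeff i := by
    intro i
    have h1 : j p ^ k * (j (c i) - U.coeff i) = 0 := by
      rw [mul_sub, hcoeff i, hc i, map_mul, map_pow, sub_self]
    exact sub_eq_zero.mp (eq_zero_of_pow_mul_eq_zero j p hreg k _ h1)
  -- `U₁ = Σ cᵢ Xⁱ` over the support of `W`
  refine ⟨∑ i ∈ W.support, C (c i) * X ^ i, ?_, ?_⟩
  · ext i
    rw [Polynomial.map_sum, finsetSum_coeff]
    simp only [Polynomial.map_mul, Polynomial.map_pow, map_C, map_X, coeff_C_mul, coeff_X_pow,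
      mul_ite, mul_one, mul_zero]
    rw [Finset.sum_ite_eq]
    split_ifs with hi
    · exact hcU i
    · -- `Wᵢ = 0` forces `Uᵢ = 0`
      have hW : W.coeff i = 0 := by simpa [mem_support_iff] using hi
      have h0 : j p ^ k * U.coeff i = 0 := by rw [hcoeff i, hW, map_zero]
      exact (eq_zero_of_pow_mul_eq_zero j p hreg k _ h0).symm
  · ext i
    rw [← C_pow, coeff_C_mul, finsetSum_coeff]
    simp only [coeff_C_mul, coeff_X_pow, mul_ite, mul_one, mul_zero]
    rw [Finset.sum_ite_eq]
    split_ifs with hi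
    · exact (hc i).symm
    · have hW : W.coeff i = 0 := by simpa [mem_support_iff] using hi
      rw [mul_zero, hW]

/-- **Congruences descend** under the same hypothesis (case `k = 1`, `x` arbitrary): if
`j(U₁) ≡ j(U₂)` coefficientwise modulo `j(p)` then `U₁ ≡ U₂` modulo `p`. [folklore] -/
theorem dvd_coeff_sub_of_dvd_coeff_map_sub
    (hdesc : ∀ (a : A) (k : ℕ) (x : B), j p ^ k * x = j a → p ^ k ∣ a) {U₁ U₂ : A[X]}
    (h : ∀ i, j p ∣ (U₁.map j - U₂.map j).coeff i) (i : ℕ) : p ∣ (U₁ - U₂).coeff i := by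
  obtain ⟨x, hx⟩ := h i
  have := hdesc ((U₁ - U₂).coeff i) 1 x (by rw [pow_one, ← hx, coeff_sub, coeff_sub, coeff_map, coeff_map, map_sub])
  rwa [pow_one] at this

end Literature.RingTheory.DiscreteValuationRing
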